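import Summits.QuantumFields.YangMills.Theorems.ColdStartUniversalityLatticeLangevinPairDynkin
import Summits.QuantumFields.YangMills.Theorems.ColdStartUniversalityLatticeLangevinQuadraticGenerator
import HarnessLib

/-!
# Route `ColdStartUniversality` (fixed-cut-off SZZ dynamics; conjugation calculus, file 4):
# THE NOISE CANCELS IN THE CONJUGATED PRODUCT `(ρU²_e)ᴴ ρU¹_e` — generator value and vanishing carré du champ

Helper file (seat `ym-line-csu-p1`, g23).  For two SZZ solutions `U¹` (coupling `β₁`) and `U²` (coupling `β₂`) on the SU(2)
lattice `(ℤ/L)³` driven by the SAME flat noise, the conjugated link product `V_e = (ρU²_e)ᴴ ρU¹_e` has NO martingale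
part: the right-invariant noise fields `Q ↦ √2·𝐩(E_m)Q` hit both factors identically and cancel in `(ρU²)ᴴ ρU¹`
(`𝐩(E_m)ᴴ = −𝐩(E_m)`), while the Itô corrections (`casimir`) and the cross-variation add up to zero.  What remains is
the drift difference: GENERATOR VALUE `(ρU²_e)ᴴ (D₁ − D₂) ρU¹_e`, `D_s = driftLie β_s (ρU^s) e ∈ 𝔰𝔲(2)`.

* `conj_generator_matrix` — the matrix identity behind it, for ARBITRARY matrix configurations:
  `(b₂ Q)ᴴ_e P_e + Q_eᴴ (b₁ P)_e + Σ_m (σ₂ Q)_{e,m}ᴴ (σ₁ P)_{e,m} = Q_eᴴ (D₁(P) − D₂(Q)) P_e` (drift/noise of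
  `latticeLangevinDynamics`), and `noise_conj_cross_eq_zero` (`(σ₂)ᴴ_{m} P + Qᴴ (σ₁)_m = 0`: zero carré du champ);
* ★ `dynkin_conjProduct_pair` — DYNKIN IDENTITIES for `F = Re/Im ((ρU²_e)ᴴ ρU¹_e)_{ij}`: (D1) with generator value
  `G = Re/Im ((ρU²_e)ᴴ (D₁ − D₂) ρU¹_e)_{ij}` and (D2) for `F²` with value `2FG` (from `dynkin_expectation_pair` and the
  closed-form quadratic generator sums; the carré du champ term vanishes by `noise_conj_cross_eq_zero`).

Next file: with `ae_forall_eq_add_integral_of_zero_carre` this gives the pathwise conjugation identity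
`(ρU²_e)ᴴρU¹_e (t) = (ρy_e)ᴴρx_e + ∫₀ᵗ (ρU²_e)ᴴ(D₁ − D₂)ρU¹_e dr` (Doss–Sussmann on the group; synchronous coupling).
THEOREMS ONLY, no sorry.  HONEST FRAMING: fixed-cut-off stochastic calculus; nothing K-uniform; no crux, rung or summit
statement is proved; the Yang–Mills mass gap is NOT proved.
-/

set_option autoImplicit false

noncomputable section

namespace Summit.QuantumFields.YangMills.Theorems.ColdStartUniversality

open MeasureTheory ProbabilityTheory Finset
open scoped NNReal Matrix ComplexConjugate
open Literature.Probability.Process Literature.MathematicalPhysics.QuantumFieldTheory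
open Literature.MathematicalPhysics.QuantumLattice (fundamentalRep fundamentalLatticeRep continuous_fundamentalRep
  fundamentalRep_mem_unitaryGroup)

/-! ## Matrix algebra: the noise cancels in the conjugated product -/

section Algebra

variable {L : ℕ}

/-- **Zero carré du champ of the conjugated product**: for every noise index `m` and arbitrary matrix configurations,
`(σ_{β₂}(Q)_{e,m})ᴴ P_e + Q_eᴴ σ_{β₁}(P)_{e,m} = 0` (`σ(Q)_{e,m} = √2 𝐩(E_m) Q_e`, `𝐩(E_m)ᴴ = −𝐩(E_m)`). [folklore] -/
theorem noise_conj_cross_eq_zero (β₁ β₂ : ℝ) (Q P : MatrixConfig 3 L (fundamentalLatticeRep 2).N) (e : Edge 3 L) (m : NoiseIdx (fundamentalLatticeRep 2).N) :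
    ((latticeLangevinDynamics (fundamentalLatticeRep 2) β₂).noise Q e m)ᴴ * P e +
      (Q e)ᴴ * ((latticeLangevinDynamics (fundamentalLatticeRep 2) β₁).noise P e m : Matrix (Fin 2) (Fin 2) ℂ) = 0 := by
  have hA : ((fundamentalLatticeRep 2).lieProj (noiseDir m))ᴴ =
      -((fundamentalLatticeRep 2).lieProj (noiseDir m) : Matrix (Fin 2) (Fin 2) ℂ) := by
    rw [← Matrix.star_eq_conjTranspose]; exact (fundamentalLatticeRep 2).star_lieProj _
  have hc : star (Real.sqrt 2 : ℂ) = (Real.sqrt 2 : ℂ) := Complex.conj_ofReal _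
  simp only [latticeLangevinDynamics_noise, Matrix.conjTranspose_smul, hc, Matrix.conjTranspose_mul, hA,
    Matrix.smul_mul, Matrix.mul_smul, Matrix.neg_mul, Matrix.mul_neg, Matrix.mul_assoc, smul_neg]
  abel

/-- The noise–noise term of the conjugated product: `Σ_m (σ_{β₂}(Q)_{e,m})ᴴ σ_{β₁}(P)_{e,m} = −2 · Q_eᴴ C_𝔤 P_e`
(`C_𝔤 = casimir = Σ_m 𝐩(E_m)²`). [folklore] -/
theorem sum_noise_conj_mul_noise (β₁ β₂ : ℝ) (Q P : MatrixConfig 3 L (fundamentalLatticeRep 2).N) (e : Edge 3 L) :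
    ∑ m : NoiseIdx (fundamentalLatticeRep 2).N, ((latticeLangevinDynamics (fundamentalLatticeRep 2) β₂).noise Q e m)ᴴ *
        ((latticeLangevinDynamics (fundamentalLatticeRep 2) β₁).noise P e m : Matrix (Fin 2) (Fin 2) ℂ) =
      (-(2 : ℂ)) • ((Q e)ᴴ * ((fundamentalLatticeRep 2).casimir) * P e) := by
  have hA : ∀ m : NoiseIdx (fundamentalLatticeRep 2).N, ((fundamentalLatticeRep 2).lieProj (noiseDir m))ᴴ =
      -((fundamentalLatticeRep 2).lieProj (noiseDir m) : Matrix (Fin 2) (Fin 2) ℂ) := fun m => by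
    rw [← Matrix.star_eq_conjTranspose]; exact (fundamentalLatticeRep 2).star_lieProj _
  have hc : star (Real.sqrt 2 : ℂ) = (Real.sqrt 2 : ℂ) := Complex.conj_ofReal _
  have h2 : (Real.sqrt 2 : ℂ) * (Real.sqrt 2 : ℂ) = 2 := by
    rw [← Complex.ofReal_mul, Real.mul_self_sqrt zero_le_two]; norm_num
  have hterm : ∀ m : NoiseIdx (fundamentalLatticeRep 2).N, ((latticeLangevinDynamics (fundamentalLatticeRep 2) β₂).noise Q e m)ᴴ *
      ((latticeLangevinDynamics (fundamentalLatticeRep 2) β₁).noise P e m) =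
      (-(2 : ℂ)) • ((Q e)ᴴ * ((fundamentalLatticeRep 2).lieProj (noiseDir m) *
        (fundamentalLatticeRep 2).lieProj (noiseDir m)) * P e) := by
    intro m
    simp only [latticeLangevinDynamics_noise, Matrix.conjTranspose_smul, hc, Matrix.conjTranspose_mul, hA,
      Matrix.smul_mul, Matrix.mul_smul, smul_smul, h2, Matrix.neg_mul, Matrix.mul_neg, Matrix.mul_assoc, smul_neg,
      neg_smul]
  simp_rw [hterm]
  rw [← Finset.smul_sum]
  congr 1
  simp only [LatticeRep.casimir, Finset.mul_sum, Finset.sum_mul]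

/-- ★ **The generator value of the conjugated product, as a matrix identity** (arbitrary matrix configurations `Q, P`,
couplings `β₂, β₁`): drift terms + Itô cross-variation of `(Q_e)ᴴ P_e` along `latticeLangevinDynamics` equal
`Q_eᴴ (D_{β₁}(P)_e − D_{β₂}(Q)_e) P_e`, `D = driftLie` (skew-Hermitian), the `casimir` corrections cancelling against the
cross-variation. [folklore] -/
theorem conj_generator_matrix (β₁ β₂ : ℝ) (Q P : MatrixConfig 3 L (fundamentalLatticeRep 2).N) (e : Edge 3 L) :
    ((latticeLangevinDynamics (fundamentalLatticeRep 2) β₂).drift Q e)ᴴ * P e +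
      (Q e)ᴴ * ((latticeLangevinDynamics (fundamentalLatticeRep 2) β₁).drift P e : Matrix (Fin 2) (Fin 2) ℂ) +
      ∑ m : NoiseIdx (fundamentalLatticeRep 2).N, ((latticeLangevinDynamics (fundamentalLatticeRep 2) β₂).noise Q e m)ᴴ *
        ((latticeLangevinDynamics (fundamentalLatticeRep 2) β₁).noise P e m : Matrix (Fin 2) (Fin 2) ℂ) =
      (Q e)ᴴ * ((fundamentalLatticeRep 2).driftLie β₁ P e - (fundamentalLatticeRep 2).driftLie β₂ Q e) * P e := by
  rw [sum_noise_conj_mul_noise]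
  have hD : ((fundamentalLatticeRep 2).driftLie β₂ Q e)ᴴ =
      -((fundamentalLatticeRep 2).driftLie β₂ Q e : Matrix (Fin 2) (Fin 2) ℂ) := by
    rw [← Matrix.star_eq_conjTranspose]
    exact (fundamentalLatticeRep 2).star_eq_neg_of_mem_lieAlg ((fundamentalLatticeRep 2).driftLie_mem_lieAlg β₂ Q e)
  have hC : ((fundamentalLatticeRep 2).casimir)ᴴ =
      ((fundamentalLatticeRep 2).casimir : Matrix (Fin 2) (Fin 2) ℂ) := by
    rw [← Matrix.star_eq_conjTranspose]; exact (fundamentalLatticeRep 2).star_casimir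
  simp only [latticeLangevinDynamics_drift, Matrix.conjTranspose_mul, Matrix.conjTranspose_add, hD, hC,
    Matrix.add_mul, Matrix.mul_add, Matrix.sub_mul, Matrix.mul_sub, Matrix.neg_mul, Matrix.mul_neg, Matrix.mul_assoc,
    neg_smul, two_smul]
  abel

end Algebra

/-! ## Dynkin identities for the conjugated product along a pair of solutions -/

/-- ★ **Dynkin identities for the conjugated product of two SZZ solutions driven by the same noise.**  For two regular
solution families `U s` (couplings `β s`), starts `x s`, a link `e`, an entry `(i,j)` and `c` (real/imaginary part),
with `F_r = Re/Im ((ρU²_e)ᴴ ρU¹_e)_{ij}(r)` (`U² = U false`, `U¹ = U true`) and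
`G_r = Re/Im ((ρU²_e)ᴴ (D_true − D_false) ρU¹_e)_{ij}(r)`, `D_s = driftLie (β s) (ρ U^s) e`: for `s₀ ≤ t` and every
bounded `𝓕_{s₀}`-measurable `Z`,
(D1) `E[Z (F_t − F_{s₀})] = E[Z ∫_(s₀,t] G_r dr]` and (D2) `E[Z (F_t² − F_{s₀}²)] = E[Z ∫_(s₀,t] 2 F_r G_r dr]`
(the carré du champ of `F` vanishes). [folklore] -/
theorem dynkin_conjProduct_pair (L : ℕ) [NeZero L] (β : Bool → ℝ) {Ω : Type} [MeasurableSpace Ω] {P : Measure Ω}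
    [IsProbabilityMeasure P] {W : ℝ≥0 → Ω → (Edge 3 L × NoiseIdx 2 → ℝ)} (hW : IsFlatBrownian W P)
    (U : Bool → GaugeConfig 3 L (Matrix.specialUnitaryGroup (Fin 2) ℂ) → ℝ≥0 → Ω →
      GaugeConfig 3 L (Matrix.specialUnitaryGroup (Fin 2) ℂ))
    (hU : ∀ s x, (∀ ω, U s x 0 ω = x) ∧
      (latticeLangevinDynamics (fundamentalLatticeRep 2) (β s)).IsSolution (fundamentalRep (Fin 2))
        hW.natFiltration P W (U s x))
    (hUm : ∀ (s : Bool) (i : ℝ≥0), Measurable[@Prod.instMeasurableSpace (Set.Iic i)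
        (GaugeConfig 3 L (Matrix.specialUnitaryGroup (Fin 2) ℂ) × Ω) inferInstance
        (@Prod.instMeasurableSpace (GaugeConfig 3 L (Matrix.specialUnitaryGroup (Fin 2) ℂ)) Ω inferInstance
          (hW.natFiltration i))]
      (fun q : Set.Iic i × (GaugeConfig 3 L (Matrix.specialUnitaryGroup (Fin 2) ℂ) × Ω) => U s q.2.1 q.1 q.2.2))
    (x : Bool → GaugeConfig 3 L (Matrix.specialUnitaryGroup (Fin 2) ℂ)) (e : Edge 3 L)
    (i j : Fin (fundamentalLatticeRep 2).N) (c : Bool) {s₀ t : ℝ≥0} (hst : s₀ ≤ t) {Z : Ω → ℝ} (hZ : StronglyMeasurable[hW.natFiltration s₀] Z) {C : ℝ}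
    (hC : ∀ ω, |Z ω| ≤ C) :
    let F : ℝ≥0 → Ω → ℝ := fun r ω => (fun z : ℂ => if c then z.im else z.re)
      (((((fundamentalLatticeRep 2).ρ (U false (x false) r ω e)))ᴴ *
        ((fundamentalLatticeRep 2).ρ (U true (x true) r ω e))) i j)
    let G : ℝ≥0 → Ω → ℝ := fun r ω => (fun z : ℂ => if c then z.im else z.re)
      (((((fundamentalLatticeRep 2).ρ (U false (x false) r ω e)))ᴴ *
        ((fundamentalLatticeRep 2).driftLie (β true) (matrixConfig (fundamentalLatticeRep 2).ρ (U true (x true) r ω)) e -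
          ((fundamentalLatticeRep 2).driftLie (β false) (matrixConfig (fundamentalLatticeRep 2).ρ (U false (x false) r ω)) e)) *
        ((fundamentalLatticeRep 2).ρ (U true (x true) r ω e))) i j)
    (∫ ω, Z ω * (F t ω - F s₀ ω) ∂P = ∫ ω, Z ω * (∫ r in Set.Ioc (s₀ : ℝ) t, G r.toNNReal ω) ∂P) ∧
    (∫ ω, Z ω * (F t ω ^ 2 - F s₀ ω ^ 2) ∂P =
      ∫ ω, Z ω * (∫ r in Set.Ioc (s₀ : ℝ) t, 2 * F r.toNNReal ω * G r.toNNReal ω) ∂P) := by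
  intro F G
  classical
  -- shorthand
  set rI : ℂ → ℝ := fun z => if c then z.im else z.re with hrI
  have hrI_add : ∀ z z' : ℂ, rI (z + z') = rI z + rI z' := by intro z z'; cases c <;> simp [hrI]
  have hrI_smul : ∀ (a : ℝ) (z : ℂ), rI (a • z) = a * rI z := by intro a z; cases c <;> simp [hrI]
  have hrI_zero : rI 0 = 0 := by cases c <;> simp [hrI]
  have hrI_sum : ∀ (s : Finset (NoiseIdx (fundamentalLatticeRep 2).N)) (f : NoiseIdx (fundamentalLatticeRep 2).N → ℂ),
      rI (∑ m ∈ s, f m) = ∑ m ∈ s, rI (f m) := by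
    intro s f
    induction s using Finset.induction_on with
    | empty => rw [Finset.sum_empty, Finset.sum_empty]; exact hrI_zero
    | insert a s ha ih => rw [Finset.sum_insert ha, Finset.sum_insert ha, hrI_add, ih]
  -- the coordinate-to-matrix assembly maps and their linearity
  let ι := Bool × (Edge 3 L × Fin 2 × Fin 2 × Bool)
  let M : Bool → (ι → ℝ) → Matrix (Fin (fundamentalLatticeRep 2).N) (Fin (fundamentalLatticeRep 2).N) ℂ :=
    fun s v k l => ⟨v (s, e, k, l, false), v (s, e, k, l, true)⟩
  have hρ : ∀ g : Matrix.specialUnitaryGroup (Fin 2) ℂ, (fundamentalLatticeRep 2).ρ g = fundamentalRep (Fin 2) g :=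
    fun g => rfl
  have hM_add : ∀ s u u', M s (u + u') = M s u + M s u' := by
    intro s u u'; ext k l
    apply Complex.ext <;> simp only [M, Matrix.add_apply, Pi.add_apply, Complex.add_re, Complex.add_im]
  have hM_smul : ∀ s (a : ℝ) u, M s (a • u) = a • M s u := by
    intro s a u; ext k l
    apply Complex.ext <;> simp only [M, Matrix.smul_apply, Pi.smul_apply, smul_eq_mul, Complex.smul_re, Complex.smul_im]
  have hM_zero : ∀ s, M s 0 = 0 := by
    intro s; ext k l
    apply Complex.ext <;> simp only [M, Matrix.zero_apply, Pi.zero_apply, Complex.zero_re, Complex.zero_im]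
  -- the bilinear form `φ(u, w) = rI ((M ff u)ᴴ (M tt w))_{ij}` as a continuous bilinear map
  let φ₀ : (ι → ℝ) → (ι → ℝ) → ℝ := fun u w => rI (((M false u)ᴴ * M true w) i j)
  have hstar : ∀ a : ℝ, star a = a := fun a => star_trivial a
  let φ : (ι → ℝ) →ₗ[ℝ] (ι → ℝ) →ₗ[ℝ] ℝ := LinearMap.mk₂ ℝ φ₀
    (fun u u' w => by
      simp only [φ₀, hM_add, Matrix.conjTranspose_add, Matrix.add_mul, Matrix.add_apply, hrI_add])
    (fun a u w => by
      simp only [φ₀, hM_smul, Matrix.conjTranspose_smul, hstar, Matrix.smul_mul, Matrix.smul_apply, hrI_smul,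
        smul_eq_mul])
    (fun u w w' => by
      simp only [φ₀, hM_add, Matrix.mul_add, Matrix.add_apply, hrI_add])
    (fun a u w => by
      simp only [φ₀, hM_smul, Matrix.mul_smul, Matrix.smul_apply, hrI_smul, smul_eq_mul])
  obtain ⟨Φ, hΦ⟩ := exists_clm_bilinear φ
  have hΦ' : ∀ u w, Φ u w = rI (((M false u)ᴴ * M true w) i j) := fun u w => by rw [hΦ]; rfl
  -- smooth compactly supported cut-offs of `g = Φ(·,·)` and of `g²`, exact near the unit ball
  obtain ⟨f₁, hf₁, hf₁c, hf₁eq⟩ := exists_contDiff_hasCompactSupport_eqOn (contDiff_quadratic Φ (n := (3 : ℕ∞))) 1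
  obtain ⟨f₂, hf₂, hf₂c, hf₂eq⟩ := exists_contDiff_hasCompactSupport_eqOn (contDiff_quadratic_sq Φ (n := (3 : ℕ∞))) 1
  -- the Dynkin formulas for the pair, applied to `f₁` and `f₂`
  have hD₁ := dynkin_expectation_pair L β hW U hU hUm x hf₁ hf₁c hst hZ hC
  have hD₂ := dynkin_expectation_pair L β hW U hU hUm x hf₂ hf₂c hst hZ hC
  -- notation for the coordinate process and coefficient vectors (as in `dynkin_expectation_pair`)
  set X : ℝ≥0 → Ω → (ι → ℝ) := fun r ω a =>
    (fun z : ℂ => if a.2.2.2.2 then z.im else z.re)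
      (((fundamentalLatticeRep 2).ρ (U a.1 (x a.1) r ω a.2.1)) a.2.2.1 a.2.2.2.1) with hX
  set bv : ℝ≥0 → Ω → (ι → ℝ) := fun r ω a =>
    (fun z : ℂ => if a.2.2.2.2 then z.im else z.re) ((latticeLangevinDynamics (fundamentalLatticeRep 2) (β a.1)).drift
      (matrixConfig (fundamentalLatticeRep 2).ρ (U a.1 (x a.1) r ω)) a.2.1 a.2.2.1 a.2.2.2.1) with hbv
  set σv : (Edge 3 L × NoiseIdx 2) → ℝ≥0 → Ω → (ι → ℝ) := fun k r ω a =>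
    if k.1 = a.2.1 then (fun z : ℂ => if a.2.2.2.2 then z.im else z.re)
      ((latticeLangevinDynamics (fundamentalLatticeRep 2) (β a.1)).noise
        (matrixConfig (fundamentalLatticeRep 2).ρ (U a.1 (x a.1) r ω)) a.2.1 k.2 a.2.2.1 a.2.2.2.1) else 0 with hσv
  -- identification of the assembled matrices
  have hMX : ∀ s r ω, M s (X r ω) = matrixConfig (fundamentalLatticeRep 2).ρ (U s (x s) r ω) e := by
    intro s r ω; ext k l; apply Complex.ext <;> simp [M, hX, matrixConfig]
  have hMb : ∀ s r ω, M s (bv r ω) = ((latticeLangevinDynamics (fundamentalLatticeRep 2) (β s)).drift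
      (matrixConfig (fundamentalLatticeRep 2).ρ (U s (x s) r ω)) e) := by
    intro s r ω; ext k l; apply Complex.ext <;> simp [M, hbv]
  have hMσ : ∀ s (k : Edge 3 L × NoiseIdx 2) r ω, M s (σv k r ω) = if k.1 = e then
      ((latticeLangevinDynamics (fundamentalLatticeRep 2) (β s)).noise
        (matrixConfig (fundamentalLatticeRep 2).ρ (U s (x s) r ω)) e k.2) else 0 := by
    intro s k r ω
    by_cases hk : k.1 = e
    · simp only [hk, if_true]; ext k' l; apply Complex.ext <;> simp [M, hσv, hk]
    · simp only [hk, if_false]; ext k' l; apply Complex.ext <;> simp [M, hσv, hk]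
  -- the range of `X` lies in the closed unit ball
  have hXbd : ∀ r ω, ‖X r ω‖ ≤ 1 := by
    intro r ω
    refine (pi_norm_le_iff_of_nonneg zero_le_one).2 fun a => ?_
    have hu := entry_norm_bound_of_unitary (fundamentalRep_mem_unitaryGroup (U a.1 (x a.1) r ω a.2.1))
      a.2.2.1 a.2.2.2.1
    rw [Real.norm_eq_abs]
    rcases a with ⟨s, e', k, l, cc⟩
    cases cc
    · exact (Complex.abs_re_le_norm _).trans hu
    · exact (Complex.abs_im_le_norm _).trans hu
  -- values: `f₁ ∘ X = F`, `f₂ ∘ X = F²`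
  have hFval : ∀ r ω, Φ (X r ω) (X r ω) = F r ω := by
    intro r ω; rw [hΦ', hMX, hMX]; exact rfl
  have hf₁val : ∀ r ω, f₁ (X r ω) = F r ω := by
    intro r ω; rw [(hf₁eq _ (hXbd r ω)).eq_of_nhds, hFval]
  have hf₂val : ∀ r ω, f₂ (X r ω) = F r ω ^ 2 := by
    intro r ω; rw [(hf₂eq _ (hXbd r ω)).eq_of_nhds, hFval, sq]
  -- (K2) the noise term, (K3) the cross terms vanish
  have hK2 : ∀ r ω, ∑ n : Edge 3 L × NoiseIdx 2, Φ (σv n r ω) (σv n r ω) =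
      rI ((∑ m : NoiseIdx (fundamentalLatticeRep 2).N, ((latticeLangevinDynamics (fundamentalLatticeRep 2) (β false)).noise
        (matrixConfig (fundamentalLatticeRep 2).ρ (U false (x false) r ω)) e m)ᴴ *
          ((latticeLangevinDynamics (fundamentalLatticeRep 2) (β true)).noise
            (matrixConfig (fundamentalLatticeRep 2).ρ (U true (x true) r ω)) e m)) i j) := by
    intro r ω
    rw [Fintype.sum_prod_type, Finset.sum_eq_single e]
    · rw [Matrix.sum_apply, hrI_sum]
      refine Finset.sum_congr rfl fun m _ => ?_
      rw [hΦ', hMσ, hMσ, if_pos rfl, if_pos rfl]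
    · intro e' _ hne
      refine Finset.sum_eq_zero fun m _ => ?_
      rw [hΦ', hMσ, if_neg hne, Matrix.conjTranspose_zero, Matrix.zero_mul]; exact hrI_zero
    · intro h; exact absurd (Finset.mem_univ e) h
  have hK3 : ∀ r ω (n : Edge 3 L × NoiseIdx 2), Φ (σv n r ω) (X r ω) + Φ (X r ω) (σv n r ω) = 0 := by
    intro r ω n
    rw [hΦ', hΦ', hMσ, hMX, hMX, hMσ]
    by_cases hn : n.1 = e
    · rw [if_pos hn, if_pos hn, ← hrI_add, ← Matrix.add_apply,
        noise_conj_cross_eq_zero (β true) (β false) (matrixConfig (fundamentalLatticeRep 2).ρ (U false (x false) r ω))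
          (matrixConfig (fundamentalLatticeRep 2).ρ (U true (x true) r ω)) e n.2]
      exact hrI_zero
    · rw [if_neg hn, if_neg hn, Matrix.conjTranspose_zero, Matrix.zero_mul, Matrix.mul_zero, Matrix.zero_apply, hrI_zero,
        add_zero]
  -- the generator value `G` (first-order terms + noise term, via `conj_generator_matrix`)
  have hGval : ∀ r ω, Φ (bv r ω) (X r ω) + Φ (X r ω) (bv r ω) + ∑ n : Edge 3 L × NoiseIdx 2, Φ (σv n r ω) (σv n r ω) =
      G r ω := by
    intro r ω
    rw [hK2, hΦ', hΦ', hMb, hMX, hMX, hMb, ← hrI_add, ← hrI_add, ← Matrix.add_apply, ← Matrix.add_apply,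
      conj_generator_matrix (β true) (β false) (matrixConfig (fundamentalLatticeRep 2).ρ (U false (x false) r ω))
        (matrixConfig (fundamentalLatticeRep 2).ρ (U true (x true) r ω)) e]
    exact rfl
  -- rearrangement of the second-order coordinate sum
  have hswap : ∀ (D : ι → ι → ℝ) (p : ι → (Edge 3 L × NoiseIdx 2) → ℝ),
      ∑ a, ∑ a', D a a' * ∑ n, p a n * p a' n = ∑ n, ∑ a, ∑ a', D a a' * p a n * p a' n := by
    intro D p
    calc ∑ a, ∑ a', D a a' * ∑ n, p a n * p a' n
        = ∑ a, ∑ a', ∑ n, D a a' * p a n * p a' n := by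
          refine Finset.sum_congr rfl fun a _ => Finset.sum_congr rfl fun a' _ => ?_
          rw [Finset.mul_sum]; exact Finset.sum_congr rfl fun n _ => by ring
      _ = ∑ a, ∑ n, ∑ a', D a a' * p a n * p a' n := Finset.sum_congr rfl fun a _ => Finset.sum_comm
      _ = ∑ n, ∑ a, ∑ a', D a a' * p a n * p a' n := Finset.sum_comm
  -- generator sums of `f₁` and `f₂` at points of the range
  have hgen₁ : ∀ r ω, (∑ a, fderiv ℝ f₁ (X r ω) (Pi.single a 1) * bv r ω a +
      (1 / 2) * ∑ a, ∑ a', fderiv ℝ (fun z => fderiv ℝ f₁ z (Pi.single a 1)) (X r ω) (Pi.single a' 1) *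
        ∑ n, σv n r ω a * σv n r ω a') = G r ω := by
    intro r ω
    obtain ⟨hloc1, hloc2⟩ := generator_terms_congr_of_eventuallyEq (hf₁eq _ (hXbd r ω))
    rw [hloc1, hswap]
    simp_rw [hloc2]
    obtain ⟨hq1, -⟩ := quadratic_generator_terms Φ (X r ω) (bv r ω) (bv r ω) (bv r ω)
    rw [hq1]
    have hq2 : ∀ n, ∑ a, ∑ a', fderiv ℝ (fun z => fderiv ℝ (fun y => Φ y y) z (Pi.single a 1)) (X r ω)
        (Pi.single a' 1) * σv n r ω a * σv n r ω a' = Φ (σv n r ω) (σv n r ω) + Φ (σv n r ω) (σv n r ω) :=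
      fun n => (quadratic_generator_terms Φ (X r ω) (bv r ω) (σv n r ω) (σv n r ω)).2
    simp_rw [hq2]
    rw [← hGval]
    have : (1 / 2 : ℝ) * ∑ n, (Φ (σv n r ω) (σv n r ω) + Φ (σv n r ω) (σv n r ω)) = ∑ n, Φ (σv n r ω) (σv n r ω) := by
      rw [Finset.mul_sum]; refine Finset.sum_congr rfl fun n _ => by ring
    rw [this]
  have hgen₂ : ∀ r ω, (∑ a, fderiv ℝ f₂ (X r ω) (Pi.single a 1) * bv r ω a +
      (1 / 2) * ∑ a, ∑ a', fderiv ℝ (fun z => fderiv ℝ f₂ z (Pi.single a 1)) (X r ω) (Pi.single a' 1) *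
        ∑ n, σv n r ω a * σv n r ω a') = 2 * F r ω * G r ω := by
    intro r ω
    obtain ⟨hloc1, hloc2⟩ := generator_terms_congr_of_eventuallyEq (hf₂eq _ (hXbd r ω))
    rw [hloc1, hswap]
    simp_rw [hloc2]
    obtain ⟨hq1, -⟩ := quadratic_sq_generator_terms Φ (X r ω) (bv r ω) (bv r ω) (bv r ω)
    rw [hq1]
    have hq2 : ∀ n, ∑ a, ∑ a', fderiv ℝ (fun z => fderiv ℝ (fun y => Φ y y * Φ y y) z (Pi.single a 1)) (X r ω)
        (Pi.single a' 1) * σv n r ω a * σv n r ω a' =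
        2 * (Φ (σv n r ω) (X r ω) + Φ (X r ω) (σv n r ω)) * (Φ (σv n r ω) (X r ω) + Φ (X r ω) (σv n r ω)) +
          2 * Φ (X r ω) (X r ω) * (Φ (σv n r ω) (σv n r ω) + Φ (σv n r ω) (σv n r ω)) :=
      fun n => (quadratic_sq_generator_terms Φ (X r ω) (bv r ω) (σv n r ω) (σv n r ω)).2
    simp_rw [hq2, hK3]
    rw [← hGval, hFval]
    have : (1 / 2 : ℝ) * ∑ n : Edge 3 L × NoiseIdx 2, (2 * (0 : ℝ) * 0 +
        2 * F r ω * (Φ (σv n r ω) (σv n r ω) + Φ (σv n r ω) (σv n r ω))) =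
        2 * F r ω * ∑ n, Φ (σv n r ω) (σv n r ω) := by
      rw [Finset.mul_sum, Finset.mul_sum]; refine Finset.sum_congr rfl fun n _ => by ring
    rw [this]; ring
  -- conclude
  have hD₁' : ∫ ω, Z ω * (f₁ (X t ω) - f₁ (X s₀ ω)) ∂P = ∫ ω, Z ω * (∫ r in Set.Ioc (s₀ : ℝ) t,
      (∑ a, fderiv ℝ f₁ (X r.toNNReal ω) (Pi.single a 1) * bv r.toNNReal ω a +
        (1 / 2) * ∑ a, ∑ a', fderiv ℝ (fun z => fderiv ℝ f₁ z (Pi.single a 1)) (X r.toNNReal ω) (Pi.single a' 1) *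
          ∑ n, σv n r.toNNReal ω a * σv n r.toNNReal ω a')) ∂P := hD₁
  have hD₂' : ∫ ω, Z ω * (f₂ (X t ω) - f₂ (X s₀ ω)) ∂P = ∫ ω, Z ω * (∫ r in Set.Ioc (s₀ : ℝ) t,
      (∑ a, fderiv ℝ f₂ (X r.toNNReal ω) (Pi.single a 1) * bv r.toNNReal ω a +
        (1 / 2) * ∑ a, ∑ a', fderiv ℝ (fun z => fderiv ℝ f₂ z (Pi.single a 1)) (X r.toNNReal ω) (Pi.single a' 1) *
          ∑ n, σv n r.toNNReal ω a * σv n r.toNNReal ω a')) ∂P := hD₂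
  simp_rw [hf₁val, hgen₁] at hD₁'
  simp_rw [hf₂val, hgen₂] at hD₂'
  exact ⟨hD₁', hD₂'⟩

end Summit.QuantumFields.YangMills.Theorems.ColdStartUniversality

end
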